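import Literature.NumberTheory.Sieve.DrappeauDispersionR1ppBlocks
import Literature.NumberTheory.Sieve.KloostermanQuintilinearDrappeauWeights
import HarnessLib

/-!
# Drappeau 2017, §5.5: reindexing `q_j = δ_j q_j'` and the weights `G` of the piece sums

Topic `Literature/NumberTheory/Sieve`, part of the formalisation of §5 of S. Drappeau, Proc. London
Math. Soc. (3) 114 (2017) 684–732 = arXiv:1504.05549 (p. 20: "up to replacing `q₁q₂` by
`q₁q₂δ₁δ₂` for some fixed `δ_j ∣ a₁`").  After the Möbius inversion
(`DrappeauDispersionR1ppMoebius`) the moduli run over multiples of `δ_j`; here the blocked piece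
sums are re-indexed by `d = q₁/δ₁`, `c = q₂/δ₂` (the smooth variables `𝐝, 𝐜` of Theorem 2.1), and
the weight `G₀(q₁,q₂) = γ(q₀q₁)γ(q₀q₂)α(q₀q₁q₂ξ/M)` is expanded into the four dyadic pieces of
`KloostermanQuintilinearDrappeauWeights` and transported along the dilation `q = δq'`.
Everything proved (no definition, no named fact).

* `sum_filter_dvd_eq_sum_image` — `∑_{q ∈ A, δ∣q} F(q) = ∑_{d ∈ (A∩δℕ)/δ} F(δd)`;
* `pieceSumBlk_reindex` — the blocked piece sum over `A₁ ∩ δ₁ℕ`, `A₂ ∩ δ₂ℕ` in the variables `d, c`;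
* `gammaDil_mul_arg`, `pieceLo_mul_arg`, `pieceHi_mul_arg` — `piece S Y q₀ (δt) = piece S Y (q₀δ) t`;
* `G0_eq_sum_four` — `γ(q₀q₁)γ(q₀q₂)α((q₀q₁q₂)ξ/M) = ∑_{i,j} piece_i(q₁) piece_j(q₂) α(κq₁q₂)`,
  `κ = q₀ξ/M`.

## References

* S. Drappeau, Proc. London Math. Soc. (3) 114 (2017) 684–732, arXiv:1504.05549, §5.5 p. 20.
  [cite: Drappeau2017, §5.5]
-/

noncomputable section

open Finset Real Complex
open scoped ArithmeticFunction.Moebius FourierTransform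

namespace Literature.NumberTheory.Sieve

namespace Drappeau2017

open KloostermanQuintilinear

/-- `∑_{q ∈ A, δ ∣ q} F(q) = ∑_{d ∈ (A ∩ δℕ)/δ} F(δ d)`. [folklore] -/
theorem sum_filter_dvd_eq_sum_image (A : Finset ℕ) (δ : ℕ) (F : ℕ → ℂ) :
    ∑ q ∈ A.filter (fun q : ℕ => δ ∣ q), F q =
      ∑ d ∈ (A.filter (fun q : ℕ => δ ∣ q)).image (fun q : ℕ => q / δ), F (δ * d) := by
  rw [Finset.sum_image]
  · refine Finset.sum_congr rfl fun q hq => ?_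
    rw [Nat.mul_div_cancel' (Finset.mem_filter.1 hq).2]
  · intro q hq q' hq' h
    have h : q / δ = q' / δ := h
    have h1 := Nat.mul_div_cancel' (Finset.mem_filter.1 hq).2
    have h2 := Nat.mul_div_cancel' (Finset.mem_filter.1 hq').2
    rw [← h1, ← h2, h]

/-- **Reindexing the blocked piece sum by `d = q₁/δ₁`, `c = q₂/δ₂`.**
[cite: Drappeau2017, §5.5 p. 20] -/
theorem pieceSumBlk_reindex (a₁ a₂ : ℤ) (A₁ A₂ B : Finset ℕ) (q₀ n₀ l₁ l₂ : ℕ) (β : ℕ → ℂ)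
    (ξ : ℝ) (G : ℕ → ℕ → ℂ) (H : ℕ) (σ : ℤ) (nlo nhi δ₁ δ₂ : ℕ) :
    pieceSumBlk a₁ a₂ (A₁.filter (fun q : ℕ => δ₁ ∣ q)) (A₂.filter (fun q : ℕ => δ₂ ∣ q)) B q₀ n₀
        l₁ l₂ β ξ G H σ nlo nhi =
      ∑ d ∈ (A₁.filter (fun q : ℕ => δ₁ ∣ q)).image (fun q : ℕ => q / δ₁),
    ∑ c ∈ (A₂.filter (fun q : ℕ => δ₂ ∣ q)).image (fun q : ℕ => q / δ₂), ∑ n₁ ∈ B, ∑ n₂ ∈ B,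
    ∑ h ∈ (Finset.Icc (-(H : ℤ)) H).filter (fun h : ℤ => h ≠ 0),
      if ((Nat.Coprime (δ₁ * d) (δ₂ * c) ∧ Nat.Coprime n₁ n₂ ∧ ((n₀ * n₁).Coprime (q₀ * (δ₁ * d)) ∧ (n₀ * n₂).Coprime (q₀ * (δ₂ * c)) ∧ n₁ ≡ n₂ [MOD q₀])) ∧
          (((nlo : ℕ) : ℤ) ≤ nVar σ a₁ a₂ q₀ h n₁ n₂ ∧ nVar σ a₁ a₂ q₀ h n₁ n₂ < ((nhi : ℕ) : ℤ))) then
            G (δ₁ * d) (δ₂ * c) * (β (n₀ * n₁) * starRingEnd ℂ (β (n₀ * n₂))) *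
              ((𝐞 (-(ξ * h)) : ℂ) *
                ((𝐞 ((h : ℝ) * a₁ * ((((n₁ : ℤ) - n₂) / q₀ : ℤ)) *
                    (((((((δ₁ * d : ℕ) : ℤ) * a₂ * n₀ * n₂ : ℤ) : ZMod (n₁ * (δ₂ * c)))⁻¹).val : ℕ) : ℝ) /
                      ((n₁ : ℝ) * ((δ₂ * c : ℕ) : ℝ))) : ℂ) *
                  (𝐞 (-((h : ℝ) * a₁ *
                    ((((((q₀ : ℤ) * l₁ * l₂ * n₁ : ℤ) : ZMod (a₂.natAbs * n₀))⁻¹).val : ℕ) : ℝ) /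
                      ((a₂ : ℝ) * n₀))) : ℂ)))
      else 0 := by
  unfold pieceSumBlk
  rw [sum_filter_dvd_eq_sum_image A₁ δ₁]
  refine Finset.sum_congr rfl fun d _ => ?_
  rw [sum_filter_dvd_eq_sum_image A₂ δ₂]

/-! ### The weights -/

/-- `γ(q₀ (δ t)) = γ((q₀δ) t)`. [folklore] -/
theorem gammaDil_mul_arg (S Y q₀ δ t : ℝ) : gammaDil S Y q₀ (δ * t) = gammaDil S Y (q₀ * δ) t := by
  unfold gammaDil; rw [mul_assoc]

/-- [folklore] -/
theorem splitDil_mul_arg (S q₀ δ t : ℝ) : splitDil S q₀ (δ * t) = splitDil S (q₀ * δ) t := by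
  unfold splitDil; rw [mul_assoc]

/-- [folklore] -/
theorem pieceLo_mul_arg (S Y q₀ δ t : ℝ) : pieceLo S Y q₀ (δ * t) = pieceLo S Y (q₀ * δ) t := by
  unfold pieceLo; rw [gammaDil_mul_arg, splitDil_mul_arg]

/-- [folklore] -/
theorem pieceHi_mul_arg (S Y q₀ δ t : ℝ) : pieceHi S Y q₀ (δ * t) = pieceHi S Y (q₀ * δ) t := by
  unfold pieceHi; rw [gammaDil_mul_arg, pieceLo_mul_arg]

/-- **The weight `G₀` of `R1pp_eq_pieceSum` as a sum of four pieces.**  With `κ = q₀ξ/M`: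
`γ(q₀q₁)γ(q₀q₂)α((q₀q₁q₂)ξ/M) = ∑_{i,j ∈ {Lo,Hi}} piece_i(q₁) piece_j(q₂) α(κ q₁ q₂)` (as complex
numbers; `γ(q₀q) = pieceLo(q) + pieceHi(q)` by `pieceLo_add_pieceHi`). [cite: Drappeau2017, §5.5] -/
theorem G0_eq_sum_four (S Y : ℝ) {q₀ : ℕ} (ξ M : ℝ) (q₁ q₂ : ℕ) :
    ((BFI.bump S Y ((q₀ * q₁ : ℕ) : ℝ) : ℝ) : ℂ) * ((BFI.bump S Y ((q₀ * q₂ : ℕ) : ℝ) : ℝ) : ℂ) *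
        BFI.bumpC 1 (1 / 2) (((q₀ * q₁ * q₂ : ℕ) : ℝ) * ξ / M) =
      pieceLo S Y q₀ q₁ * pieceLo S Y q₀ q₂ * alphaProfile ((q₀ : ℝ) * ξ / M * q₁ * q₂) +
      pieceLo S Y q₀ q₁ * pieceHi S Y q₀ q₂ * alphaProfile ((q₀ : ℝ) * ξ / M * q₁ * q₂) +
      pieceHi S Y q₀ q₁ * pieceLo S Y q₀ q₂ * alphaProfile ((q₀ : ℝ) * ξ / M * q₁ * q₂) +
      pieceHi S Y q₀ q₁ * pieceHi S Y q₀ q₂ * alphaProfile ((q₀ : ℝ) * ξ / M * q₁ * q₂) := by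
  have h1 : ((BFI.bump S Y ((q₀ * q₁ : ℕ) : ℝ) : ℝ) : ℂ) = pieceLo S Y q₀ q₁ + pieceHi S Y q₀ q₁ := by
    rw [pieceLo_add_pieceHi]; unfold gammaDil; rw [BFI.bumpC_apply]; push_cast; ring_nf
  have h2 : ((BFI.bump S Y ((q₀ * q₂ : ℕ) : ℝ) : ℝ) : ℂ) = pieceLo S Y q₀ q₂ + pieceHi S Y q₀ q₂ := by
    rw [pieceLo_add_pieceHi]; unfold gammaDil; rw [BFI.bumpC_apply]; push_cast; ring_nf
  have h3 : BFI.bumpC 1 (1 / 2) (((q₀ * q₁ * q₂ : ℕ) : ℝ) * ξ / M) =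
      alphaProfile ((q₀ : ℝ) * ξ / M * q₁ * q₂) := by
    unfold alphaProfile; congr 1; push_cast; ring
  rw [h1, h2, h3]; ring

end Drappeau2017

end Literature.NumberTheory.Sieve

end
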